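import Summits.HodgeConjecture.HodgeConjecture.Theses.NoetherLefschetzOneUp
import Literature.AlgebraicGeometry.Motives.FiberNetExistenceProofs
import Literature.AlgebraicGeometry.Motives.FiberNetExistence
import Literature.AlgebraicGeometry.Motives.SurfaceNetGeometricGenus
import HarnessLib

/-!
# Route NoetherLefschetzOneUp — `GenericGeometricGenus` (item stmt-HodgeConjecture-15374): generic constancy of the geometric genus in a surface net

Stub `stub_genericGeometricGenus` of line `birth` of the crux `FourfoldsGrantedK3Nets`
(stmt-HodgeConjecture-14599): for every smooth projective complex fourfold `X` and every surface
net `N : SurfaceNet 2 X` over `ℙ²` there are a non-empty Zariski-open `V` inside the smooth base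
`U = ℙ² ∖ Δ` and ONE `g` such that every fibre `N.fiber b` over a `ℂ`-point `b` of `V` admits a
Hodge model `A` with `dim_ℂ A.hodgePQ 2 2 0 = g` (`p_g` is generically constant).

Proof on the tree's carriers: take `V := U` itself. It is non-empty by generic smoothness in
characteristic `0` (`FiberNet.smoothBase_nonempty_of_charZero`, Hartshorne III Cor. 10.7), and the
constancy of the Hodge number `h^{2,0}` of the smooth fibres over ALL of `U` is the discharged named
fact `fiberNet_exists_hasFibreHodgeNumber_holds` (Voisin I Cor. 9.19 / Prop. 9.20 for nets: upper
semicontinuity of the Hodge numbers of the smooth family, constancy of the Betti numbers, and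
connectedness of `U(ℂ)`), specialised to `r = m = 2`, `(k, p, q) = (2, 2, 0)`.

Result: `stub_genericGeometricGenus : GenericGeometricGenus` (sorry-free, standard axioms); with
the landed glue `Theorems.netReduction_of_generic_geometricGenus` it yields `NetReduction`.
-/

-- `Summit.HodgeConjecture.HodgeConjecture.Theorems` is the mandated namespace (single-problem summit),
-- flagged by `linter.dupNamespace`; the lakefile turns the linter off tree-wide, restated here.
set_option linter.dupNamespace false

noncomputable section

open CategoryTheory AlgebraicGeometry
open Literature.AlgebraicGeometry Literature.AlgebraicGeometry.Motives
open Literature.AlgebraicGeometry.HodgeTheory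

namespace Summit.HodgeConjecture.HodgeConjecture.Theorems

/-- **Generic constancy of the geometric genus in a surface net** (route item
`GenericGeometricGenus`, stmt-HodgeConjecture-15374): for every smooth projective complex fourfold
`X` and every surface net `N : SurfaceNet 2 X` over `ℙ²` there are a non-empty Zariski-open `V`
inside the smooth base and ONE `g : ℕ` such that every fibre over a `ℂ`-point of `V` admits a Hodge
model with `dim_ℂ H^{2,0} = g`. Here `V` is the whole smooth base `U = ℙ² ∖ Δ`, non-empty by
generic smoothness (Hartshorne III Cor. 10.7), and `g` is the constant value of `h^{2,0}` on the
smooth fibres (Voisin I Cor. 9.19 / Prop. 9.20 for nets, `fiberNet_exists_hasFibreHodgeNumber_holds`).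
[cite: VoisinHodgeI2002, §9.3.1 Cor. 9.19 and §9.3.2 Prop. 9.20] [cite: Hartshorne1977, III Cor. 10.7] -/
theorem stub_genericGeometricGenus :
    Summit.HodgeConjecture.HodgeConjecture.Theses.NoetherLefschetzOneUp.GenericGeometricGenus := by
  unfold Summit.HodgeConjecture.HodgeConjecture.Theses.NoetherLefschetzOneUp.GenericGeometricGenus
  intro X _hX N
  obtain ⟨g, hg⟩ :=
    Literature.AlgebraicGeometry.Motives.fiberNet_exists_hasFibreHodgeNumber_holds 2 2 N 2 2 0
  exact ⟨N.smoothBase, N.smoothBase_nonempty_of_charZero, le_rfl, g, fun b hb => hg b hb⟩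

end Summit.HodgeConjecture.HodgeConjecture.Theorems

end
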